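import Mathlib
import Summits.Ventures.LatticeQCDFlow.TrivializingMaps.AnalyticFlowAction
import Summits.Ventures.LatticeQCDFlow.TrivializingMaps.WilsonFlowActionSeries
import Summits.Ventures.LatticeQCDFlow.TrivializingMaps.LuscherSection3Unconditional
import Summits.Ventures.LatticeQCDFlow.TrivializingMaps.LoopActionGaugeInvariance
import HarnessLib

/-!
# A trivializing map for the SU(n) Wilson action at strong coupling, in every volume

HONEST FRAMING: exact (Metropolis-corrected) sampling algorithms for lattice gauge theory; figures
of merit are autocorrelation/cost numbers at stated couplings and volumes; no continuum-physics claim.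
The theorem below concerns Lüscher's construction on FINITE periodic lattices `(ℤ/L)^d`; "every volume"
means the coupling window does not depend on `L`.  No continuum or large-`β` statement is made.

M. Lüscher, *Trivializing maps, the Wilson flow and the HMC algorithm*, CMP 293 (2010) 899–919
[Luscher2010Trivializing].  Lüscher's existence proof for trivializing maps (§4.2: "a constructive proof of
the existence of trivializing flows has thus been given") rests on two analytic inputs that the tree keeps
as CITED statements: the solvability of the flow equation `𝓛_t S̃_t = S + Ċ_t` (4.5) for all `t ∈ [0,1]`
(`TrivializingFlowExists`, App. E: ellipticity, spectral gap, elliptic regularity, Sobolev) and, at the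
start, Moser's theorem (`TrivializingMapExists`).  For the WILSON action `β·S_W` at STRONG COUPLING neither
is needed: the power series `S̃_t = ∑_k t^k β^{k+1} S̃^{(k)}` (4.11) converges up to `t = 1` as soon as
`|β|` is below a volume-independent threshold (THEOREM A, `GradedTheoremA`), its sum solves (4.5) on
`SU(n)^E` (`WilsonFlowActionSeries.luscherL_wilsonSeries_eq`), it extends to a jointly smooth flow action
on `ℝ × M_n(ℂ)^E` (`AnalyticFlowAction`), its gradient flow exists for all times (§3.1, PROVED:
`flowGlobalExistence_holds`) and exact solutions of (4.5) trivialize (§4.1 with (3.9), PROVED: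
`isTrivializingMap_of_flowEquation'`).  Hence:

* `exists_trivializingFlow_smul_ambWilsonAction` — **for every `d`, `n ≠ 0` and orthonormal basis `B` of
  `𝔰𝔲(n)` there is `β₀ = β₀(d,n,B) > 0` such that for EVERY lattice size `L` and every `|β| < β₀`, the
  time-one map of the flow of `Z_t = -∂S̃_t` is a trivializing map of `β·S_W`:
  `(Φ_1)_* D[V] = 𝒵⁻¹ e^{-β S_W} D[U]`** (with the flow `Φ`, its flow property, joint continuity and
  GAUGE EQUIVARIANCE at every time, §6 — the flow action is read at a smoothly clamped time `σ(t)`,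
  `σ = id` on `[0,1]`, `|σ| ≤ 2`, so that every time slice is a value of the gauge-invariant series);
* `exists_isTrivializingMap_smul_ambWilsonAction` — the bare existence statement (a continuous,
  gauge-equivariant trivializing map of `SU(n)^E` for `β·S_W`, `|β| < β₀`, every `L`).

This is the content of the cited `TrivializingMapExists` / `TrivializingFlowExists` for the Wilson action
in the strong-coupling window, kernel-checked and volume-uniform; the threshold `β₀ = (n^8 θ₁ 3^5 + 1)⁻¹`
is qualitative (THEORY-1 §20.1 evaluates `θ₁`).  The general smooth action of the cited statements, the
diffeomorphism clause of `TrivializingMapExists` and any `β` beyond the window are NOT claimed.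
Authored by the pub-lqcd lean-2 seat (cell lqcd-flow, FANOUT row 31 GEN-4). Tags: [ours] = venture work.
-/

noncomputable section

namespace Summit.Ventures.LatticeQCDFlow.TrivializingMaps

open MeasureTheory
open scoped Matrix Matrix.Norms.Frobenius ContDiff Topology
open Literature.MathematicalPhysics.QuantumFieldTheory
open Literature.MathematicalPhysics.QuantumFieldTheory.Luscher2010
open GradedSeries AnalyticSeries
open Summit.Ventures.LatticeQCDFlow.Exactness (IsGaugeEquivariant)

namespace StrongCoupling

variable {d L n : ℕ} [NeZero L]

/-! ## §1. Lüscher's operator only sees the field manifold -/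

/-- **`𝓛_t` on the manifold only sees the restriction**: if `φ = ψ` on `SU(n)^E` then
`𝓛_t φ = 𝓛_t ψ` on `SU(n)^E` (both link derivatives in (4.6) are along curves inside the manifold).
[cite: Luscher2010Trivializing, §4.2 eq. (4.6)] -/
theorem luscherL_coeConfig_congr (B : SuBasis n) (S : AmbConfig d L n → ℝ) (t : ℝ)
    {φ ψ : AmbConfig d L n → ℝ}
    (h : ∀ U : GaugeConfig d L (Matrix.specialUnitaryGroup (Fin n) ℂ),
      φ (WilsonFlow.coeConfig U) = ψ (WilsonFlow.coeConfig U))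
    (U : GaugeConfig d L (Matrix.specialUnitaryGroup (Fin n) ℂ)) :
    luscherL B S t φ (WilsonFlow.coeConfig U) = luscherL B S t ψ (WilsonFlow.coeConfig U) := by
  have h1 : ∀ (e : Edge d L) (a : B.ι) (V : GaugeConfig d L (Matrix.specialUnitaryGroup (Fin n) ℂ)),
      linkDeriv e (B.T a) φ (WilsonFlow.coeConfig V) = linkDeriv e (B.T a) ψ (WilsonFlow.coeConfig V) :=
    fun e a V => linkDeriv_coeConfig_congr h e (B.mem a) V
  have h2 : ∀ (e : Edge d L) (a : B.ι),
      linkDeriv e (B.T a) (linkDeriv e (B.T a) φ) (WilsonFlow.coeConfig U) =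
        linkDeriv e (B.T a) (linkDeriv e (B.T a) ψ) (WilsonFlow.coeConfig U) :=
    fun e a => linkDeriv_coeConfig_congr (fun V => h1 e a V) e (B.mem a) U
  unfold luscherL linkLap
  simp only [h1 _ _ U, h2]

/-! ## §2. The coupling window -/

/-- **The strong-coupling threshold** `β₀(d,n,B) = (n^8 θ₁(d,n,B) 3^5 + 1)⁻¹` — independent of the
lattice size. [ours] -/
def beta0 (d n : ℕ) (B : SuBasis n) : ℝ := ((n : ℝ) ^ 8 * theta1 d n B * 3 ^ 5 + 1)⁻¹

omit [NeZero L] in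
/-- `β₀ > 0`. [ours] -/
theorem beta0_pos (d n : ℕ) (B : SuBasis n) : 0 < beta0 d n B := by
  unfold beta0
  have hθ : 0 ≤ theta1 d n B := zero_le_one.trans (one_le_theta1 d n B)
  positivity

omit [NeZero L] in
/-- Inside the window the analyticity hypothesis of `AnalyticFlowAction` holds: `|β| n^8 θ₁ 3^5 ≤ 1`.
[ours] -/
theorem window_analytic {β : ℝ} {B : SuBasis n} (hβ : |β| < beta0 d n B) :
    |β| * ((n : ℝ) ^ 8 * theta1 d n B * 3 ^ 5) ≤ 1 := by
  have hθ : 0 ≤ theta1 d n B := zero_le_one.trans (one_le_theta1 d n B)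
  set X : ℝ := (n : ℝ) ^ 8 * theta1 d n B * 3 ^ 5 with hX
  have hX0 : 0 ≤ X := by positivity
  have hX1 : 0 < X + 1 := by positivity
  have h1 : |β| * X ≤ beta0 d n B * X := mul_le_mul_of_nonneg_right hβ.le hX0
  have h2 : beta0 d n B * X ≤ 1 := by
    unfold beta0
    rw [← hX, inv_mul_le_iff₀ hX1]
    linarith
  exact h1.trans h2

omit [NeZero L] in
/-- Inside the window the convergence hypothesis of `WilsonFlowActionSeries` holds up to `t = 1`:
`|t|·|β| < θ₁⁻¹` for `|t| ≤ 1` (`n ≠ 0`). [ours] -/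
theorem window_series (hn : n ≠ 0) {β t : ℝ} {B : SuBasis n} (hβ : |β| < beta0 d n B) (ht : |t| ≤ 1) :
    |t| * |β| < (theta1 d n B)⁻¹ := by
  have hθ1 : 1 ≤ theta1 d n B := one_le_theta1 d n B
  have hθ : 0 < theta1 d n B := zero_lt_one.trans_le hθ1
  have hn1 : (1 : ℝ) ≤ (n : ℝ) := by exact_mod_cast Nat.one_le_iff_ne_zero.2 hn
  set X : ℝ := (n : ℝ) ^ 8 * theta1 d n B * 3 ^ 5 with hX
  have hX1 : 0 < X + 1 := by positivity
  -- `θ₁ ≤ X`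
  have hθX : theta1 d n B ≤ X := by
    rw [hX]
    have h8 : (1 : ℝ) ≤ (n : ℝ) ^ 8 := one_le_pow₀ hn1
    nlinarith
  -- `|β| (X + 1) < 1`
  have hb : |β| * (X + 1) < 1 := by
    have := mul_lt_mul_of_pos_right hβ hX1
    rwa [beta0, ← hX, inv_mul_cancel₀ hX1.ne'] at this
  have hkey : |t| * |β| * theta1 d n B < 1 := by
    calc |t| * |β| * theta1 d n B ≤ 1 * |β| * X := by
          gcongr
      _ = |β| * X := by ring
      _ ≤ |β| * (X + 1) := by nlinarith [abs_nonneg β]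
      _ < 1 := hb
  rw [inv_eq_one_div, lt_div_iff₀ hθ]
  exact hkey

/-! ## §3. A smooth time clamp and the gauge-invariant flow action -/

/-- **The time clamp** `σ(t) = t · S(t+1) · (1 - S(t-1))` (`S` = `Real.smoothTransition`): smooth, equal to
`t` on `[0,1]`, and `|σ(t)| ≤ 2` everywhere.  Reading the flow action at time `σ(t)` instead of `t` changes
nothing on `[0,1]` (where the flow is used) and keeps every time slice equal, on `SU(n)^E`, to a value of
the summed Lüscher series — hence gauge invariant. [ours] -/
def clamp (t : ℝ) : ℝ := t * (Real.smoothTransition (t + 1) * (1 - Real.smoothTransition (t - 1)))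

omit [NeZero L] in
/-- The clamp is smooth. [ours] -/
theorem contDiff_clamp : ContDiff ℝ ∞ clamp := by
  unfold clamp
  exact contDiff_id.mul ((Real.smoothTransition.contDiff.comp (contDiff_id.add contDiff_const)).mul
    (contDiff_const.sub (Real.smoothTransition.contDiff.comp (contDiff_id.sub contDiff_const))))

omit [NeZero L] in
/-- The clamp is the identity on `[0,1]`. [ours] -/
theorem clamp_eq_self {t : ℝ} (ht : t ∈ Set.Icc (0 : ℝ) 1) : clamp t = t := by
  unfold clamp
  rw [Real.smoothTransition.one_of_one_le (by linarith [ht.1]),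
    Real.smoothTransition.zero_of_nonpos (by linarith [ht.2])]
  ring

omit [NeZero L] in
/-- `|σ(t)| ≤ 2`. [ours] -/
theorem abs_clamp_le (t : ℝ) : |clamp t| ≤ 2 := by
  unfold clamp
  have h0 : 0 ≤ Real.smoothTransition (t + 1) := Real.smoothTransition.nonneg _
  have h1 : Real.smoothTransition (t + 1) ≤ 1 := Real.smoothTransition.le_one _
  have h2 : 0 ≤ 1 - Real.smoothTransition (t - 1) := sub_nonneg.2 (Real.smoothTransition.le_one _)
  have h3 : 1 - Real.smoothTransition (t - 1) ≤ 1 := by linarith [Real.smoothTransition.nonneg (t - 1)]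
  have hfac : |Real.smoothTransition (t + 1) * (1 - Real.smoothTransition (t - 1))| ≤ 1 := by
    rw [abs_of_nonneg (mul_nonneg h0 h2)]
    exact mul_le_one₀ h1 h2 h3
  by_cases ht : |t| ≤ 2
  · rw [abs_mul]
    calc |t| * |Real.smoothTransition (t + 1) * (1 - Real.smoothTransition (t - 1))| ≤ 2 * 1 :=
          mul_le_mul ht hfac (abs_nonneg _) zero_le_two
      _ = 2 := mul_one 2
  · rw [not_le] at ht
    rcases lt_or_gt_of_ne (show t ≠ 0 by intro h; rw [h, abs_zero] at ht; linarith) with hneg | hpos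
    · have : t < -2 := by
        have := neg_abs_le t; rw [abs_of_neg hneg] at ht; linarith
      rw [Real.smoothTransition.zero_of_nonpos (by linarith : t + 1 ≤ 0), zero_mul, mul_zero, abs_zero]
      exact zero_le_two
    · have : 2 < t := by rw [abs_of_pos hpos] at ht; exact ht
      rw [Real.smoothTransition.one_of_one_le (by linarith : 1 ≤ t - 1), sub_self, mul_zero, mul_zero,
        abs_zero]
      exact zero_le_two

/-- **The gauge-invariant flow action** `S̃^G_t := flowAction B β (σ(t))`: jointly smooth, equal to
`flowAction B β t` for `t ∈ [0,1]`, and on `SU(n)^E` equal at EVERY time to the summed series at time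
`σ(t) ∈ [-2,2]`. [ours] -/
def flowActionG (B : SuBasis n) (β : ℝ) (t : ℝ) (W : AmbConfig d L n) : ℝ :=
  flowAction (d := d) (L := L) B β (clamp t) W

/-- Joint smoothness of the clamped flow action. [ours] -/
theorem contDiff_flowActionG (hn : n ≠ 0) (B : SuBasis n) {β : ℝ}
    (hβ : |β| * ((n : ℝ) ^ 8 * theta1 d n B * 3 ^ 5) ≤ 1) :
    ContDiff ℝ ∞ fun p : ℝ × AmbConfig d L n => flowActionG (d := d) (L := L) B β p.1 p.2 := by
  have h : (fun p : ℝ × AmbConfig d L n => flowActionG (d := d) (L := L) B β p.1 p.2) =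
      (fun p : ℝ × AmbConfig d L n => flowAction (d := d) (L := L) B β p.1 p.2) ∘
        fun p : ℝ × AmbConfig d L n => (clamp p.1, p.2) := by
    funext p; rfl
  rw [h]
  exact (contDiff_flowAction hn B hβ).comp ((contDiff_clamp.comp contDiff_fst).prodMk contDiff_snd)

/-- On `SU(n)^E`, at every time, the clamped flow action is the summed series at time `σ(t)`. [ours] -/
theorem flowActionG_coeConfig (B : SuBasis n) (β t : ℝ)
    (U : GaugeConfig d L (Matrix.specialUnitaryGroup (Fin n) ℂ)) :
    flowActionG (d := d) (L := L) B β t (WilsonFlow.coeConfig U) =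
      ∑' k, clamp t ^ k * (β ^ (k + 1) * gradedSk (d := d) (L := L) B k (WilsonFlow.coeConfig U)) :=
  flowAction_coeConfig B β (abs_clamp_le t) U

/-- **Every time slice of the clamped flow action is gauge invariant on `SU(n)^E`** (each order of a
Lüscher series of `β·S_W` is, `IsLuscherSeries.gaugeInvariant_of_smul_ambWilsonAction`). [ours] -/
theorem isGaugeInvariant_flowActionG (B : SuBasis n) (β t : ℝ) :
    IsGaugeInvariant fun U : GaugeConfig d L (Matrix.specialUnitaryGroup (Fin n) ℂ) =>
      flowActionG (d := d) (L := L) B β t (WilsonFlow.coeConfig U) := by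
  intro g U
  simp only [flowActionG_coeConfig]
  refine tsum_congr fun k => ?_
  have h := IsLuscherSeries.gaugeInvariant_of_smul_ambWilsonAction β (isLuscherSeries_smul_gradedSk (d := d)
    (L := L) B β) (contDiff_smul_gradedSk B β) k g U
  simp only at h
  rw [h]

/-! ## §4. The trivializing flow -/

/-- **Lüscher's trivializing flow for the Wilson action at strong coupling, every volume (ours; PROVED).**
For every `d`, `n ≠ 0` and orthonormal basis `B` of `𝔰𝔲(n)`, and for every lattice size `L` and coupling
`|β| < β₀(d,n,B)`: the summed, smoothly extended and time-clamped Lüscher flow action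
`S̃_t = flowActionG B β t` (`= ∑_k t^k β^{k+1} S̃^{(k)}` on `[0,1] × SU(n)^E`) generates, through
`Z_t = -∂S̃_t` (4.4), a flow `Φ` of `SU(n)^E`, jointly continuous, GAUGE EQUIVARIANT at every time (§6),
whose time-one map is a TRIVIALIZING MAP of `β·S_W`: `(Φ_1)_* D[V] = 𝒵⁻¹ e^{-β S_W} D[U]`.
[ours; cite: Luscher2010Trivializing, §3.1, §4.1–§4.3, §4.5(b), §6] -/
theorem exists_trivializingFlow_smul_ambWilsonAction (hn : n ≠ 0) (B : SuBasis n) {β : ℝ}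
    (hβ : |β| < beta0 d n B) :
    ∃ Φ : ℝ → GaugeConfig d L (Matrix.specialUnitaryGroup (Fin n) ℂ) →
        GaugeConfig d L (Matrix.specialUnitaryGroup (Fin n) ℂ),
      IsFlowMap (fun t W => -linkGrad B (flowActionG (d := d) (L := L) B β t) W) Φ ∧
      Continuous (fun p : ℝ × GaugeConfig d L (Matrix.specialUnitaryGroup (Fin n) ℂ) => Φ p.1 p.2) ∧
      (∀ t, IsGaugeEquivariant (Φ t)) ∧
      IsTrivializingMap
        (fun U : GaugeConfig d L (Matrix.specialUnitaryGroup (Fin n) ℂ) =>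
          β * ambWilsonAction (WilsonFlow.coeConfig U)) (Φ 1) := by
  haveI : SecondCountableTopology (Matrix (Fin n) (Fin n) ℂ) :=
    inferInstanceAs (SecondCountableTopology (Fin n → Fin n → ℂ))
  haveI : SecondCountableTopology (Matrix.specialUnitaryGroup (Fin n) ℂ) :=
    Topology.IsEmbedding.subtypeVal.secondCountableTopology
  -- the flow action is jointly smooth
  have hF : ContDiff ℝ ∞ fun p : ℝ × AmbConfig d L n => flowActionG (d := d) (L := L) B β p.1 p.2 :=
    contDiff_flowActionG hn B (window_analytic hβ)
  have hS : ContDiff ℝ ∞ fun W : AmbConfig d L n => β * ambWilsonAction W :=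
    contDiff_const.mul contDiff_ambWilsonAction
  have hZ1 := contDiff_one_neg_linkGrad_param B hF
  have hZt := isTangent_neg_linkGrad B (flowActionG (d := d) (L := L) B β)
  -- the flow of `Z_t = -∂S̃_t` exists for all times (§3.1, proved)
  obtain ⟨Φ, hΦ, hcont, -⟩ := flowGlobalExistence_holds (d := d) (L := L) (n := n)
    (fun t W => -linkGrad B (flowActionG (d := d) (L := L) B β t) W) hZ1 hZt
  have hΦ1c : Continuous (Φ 1) := hcont.comp (continuous_const.prodMk continuous_id)
  -- gauge equivariance at every time (§6, proved for gauge-invariant flow actions)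
  have hgauge : ∀ t, IsGaugeEquivariant (Φ t) :=
    isGaugeEquivariant_flowMap' B (isGaugeInvariant_flowActionG B β)
      (fun t => (hF.comp (contDiff_const.prodMk contDiff_id)).differentiable (by simp)) hZ1 hZt hΦ
  -- the flow equation (4.5) holds exactly on `[0,1] × SU(n)^E`
  have hsol : ∀ t ∈ Set.Icc (0 : ℝ) 1, ∀ U : GaugeConfig d L (Matrix.specialUnitaryGroup (Fin n) ℂ),
      luscherL B (fun W => β * ambWilsonAction W) t (flowActionG (d := d) (L := L) B β t)
          (WilsonFlow.coeConfig U) =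
        β * ambWilsonAction (WilsonFlow.coeConfig U) +
          ∑' k, t ^ k * (β ^ (k + 1) * gradedConst (d := d) (L := L) B k) := by
    intro t ht U
    have ht1 : |t| ≤ 1 := abs_le.2 ⟨by linarith [ht.1], ht.2⟩
    have hval : ∀ V : GaugeConfig d L (Matrix.specialUnitaryGroup (Fin n) ℂ),
        flowActionG (d := d) (L := L) B β t (WilsonFlow.coeConfig V) =
          ∑' k, t ^ k * (β ^ (k + 1) * gradedSk (d := d) (L := L) B k (WilsonFlow.coeConfig V)) := by
      intro V
      rw [flowActionG_coeConfig, clamp_eq_self ht]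
    rw [luscherL_coeConfig_congr B _ t
      (ψ := fun W => ∑' k, t ^ k * (β ^ (k + 1) * gradedSk (d := d) (L := L) B k W)) hval U]
    exact luscherL_wilsonSeries_eq B hn (window_series hn hβ ht1) U
  exact ⟨Φ, hΦ, hcont, hgauge, isTrivializingMap_of_flowEquation' B hS hF hΦ hΦ1c.measurable hsol⟩

/-- **Existence of trivializing maps for the SU(n) Wilson action at strong coupling, uniformly in the
volume (ours; PROVED).**  For every `d`, `n ≠ 0` and orthonormal basis `B` of `𝔰𝔲(n)` there is `β₀ > 0`
such that for EVERY lattice size `L ≥ 1` and every coupling `|β| < β₀` the Wilson theory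
`𝒵⁻¹ e^{-β S_W(U)} D[U]` on `SU(n)^E` admits a continuous, GAUGE-EQUIVARIANT trivializing map `𝓕`:
`𝓕_* D[V] = 𝒵⁻¹ e^{-β S_W} D[U]`, i.e. `⟨𝒪⟩ = ∫ D[V] 𝒪(𝓕(V))` for every observable (Lüscher (2.9)), and
`𝓕(V^g) = 𝓕(V)^g` (§6).  The map is Lüscher's: the time-one map of the gradient flow of the summed
flow-action series.
[ours; cite: Luscher2010Trivializing, §1, §2.3 eq. (2.9), §4.2] -/
theorem exists_isTrivializingMap_smul_ambWilsonAction (hn : n ≠ 0) (B : SuBasis n) :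
    ∃ β₀ : ℝ, 0 < β₀ ∧ ∀ (L : ℕ) [NeZero L] (β : ℝ), |β| < β₀ →
      ∃ F : GaugeConfig d L (Matrix.specialUnitaryGroup (Fin n) ℂ) →
          GaugeConfig d L (Matrix.specialUnitaryGroup (Fin n) ℂ),
        Continuous F ∧ IsGaugeEquivariant F ∧
        IsTrivializingMap
          (fun U : GaugeConfig d L (Matrix.specialUnitaryGroup (Fin n) ℂ) =>
            β * ambWilsonAction (WilsonFlow.coeConfig U)) F := by
  refine ⟨beta0 d n B, beta0_pos d n B, fun L _ β hβ => ?_⟩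
  obtain ⟨Φ, -, hcont, hgauge, htriv⟩ :=
    exists_trivializingFlow_smul_ambWilsonAction (d := d) (L := L) hn B hβ
  exact ⟨Φ 1, hcont.comp (continuous_const.prodMk continuous_id), hgauge 1, htriv⟩

/-- **Expectation values through the trivializing map** (Lüscher (2.9) for the Wilson theory at strong
coupling): `⟨𝒪⟩_{β S_W} = ∫ D[V] 𝒪(𝓕(V))` for every observable `𝒪` that is a.e.-strongly measurable for the
Boltzmann measure. [ours; cite: Luscher2010Trivializing, §2.3 eq. (2.9)] -/
theorem exists_integral_comp_smul_ambWilsonAction (hn : n ≠ 0) (B : SuBasis n) :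
    ∃ β₀ : ℝ, 0 < β₀ ∧ ∀ (L : ℕ) [NeZero L] (β : ℝ), |β| < β₀ →
      ∃ F : GaugeConfig d L (Matrix.specialUnitaryGroup (Fin n) ℂ) →
          GaugeConfig d L (Matrix.specialUnitaryGroup (Fin n) ℂ),
        Continuous F ∧
        ∀ O : GaugeConfig d L (Matrix.specialUnitaryGroup (Fin n) ℂ) → ℝ,
          AEStronglyMeasurable O (boltzmannMeasure fun U : GaugeConfig d L (Matrix.specialUnitaryGroup (Fin n) ℂ) =>
            β * ambWilsonAction (WilsonFlow.coeConfig U)) →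
          ∫ U, O U ∂(boltzmannMeasure fun U : GaugeConfig d L (Matrix.specialUnitaryGroup (Fin n) ℂ) =>
              β * ambWilsonAction (WilsonFlow.coeConfig U)) =
            ∫ V, O (F V) ∂(trivialMeasure (Matrix.specialUnitaryGroup (Fin n) ℂ) d L) := by
  obtain ⟨β₀, hβ₀, h⟩ := exists_isTrivializingMap_smul_ambWilsonAction (d := d) hn B
  refine ⟨β₀, hβ₀, fun L _ β hβ => ?_⟩
  obtain ⟨F, hF, -, htriv⟩ := h L β hβ
  exact ⟨F, hF, fun O hO => htriv.integral_comp hO⟩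

end StrongCoupling

end Summit.Ventures.LatticeQCDFlow.TrivializingMaps

end
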